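import Summits.MatrixMultiplication.OmegaCensus.SmallFormats.GF2ForcedProduct
import HarnessLib

/-!
# ω-census family (a), GF(2) rank floors: orbit certificates and the sweep

Cell `pub-omega` (unit `pub-omega-lit`, gen 4), topic `Summits/MatrixMultiplication/OmegaCensus` (sub-folder
`SmallFormats`). Framing (verbatim): lottery ticket; floor = certified bounds/negative ranges. HONEST FRAMING:
replay infrastructure (design note `pub-omega-lit/KERNEL-GF2-FLOORS-DESIGN.md` §7, layer R5) — a kernel
CHECKER for independently regenerated Wang-2026-style certificates of lower bounds `b ≤ R_{𝔽₂}(⟨l,m,n⟩)`;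
the instances (data + `decide`) live in sibling files. Nothing here is progress on `ω`. PROVED, no facts.

A certificate is a list of orbits (constraint lists `K`, Wang 2026 §3–§4) in an order where every lookup
points backwards, each with a claimed bound and a list of steps justifying it: flattening checks
(`GF2FlatteningCheck`), table lookups along explicit sandwiches (`GF2OrbitChecks`, Wang Lemma 1), the
forced product (`GF2ForcedProduct`, HK71 Lemma 2) and DFS rounds of substitution with backtracking replayed
through the landed `BCert.check` / `le_card_of_check_root` (`Literature/…/SubstitutionBacktracking.lean`,
Wang §6–§7). `sweep` proves every claimed bound; `le_tensorRank_of_sweep` reads off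
`b ≤ tensorRank (matMulTensor (ZMod 2) l m n)` at the unconstrained orbit.
-/

namespace Summit.MatrixMultiplication.OmegaCensus.GF2RankLB

open Module Matrix Literature.Computability.AlgebraicComplexity

/-! ## Certificate format -/

/-- One justification step for an orbit bound. -/
inductive Step
  /-- first flattening: rows = the listed elements of `S_K` -/
  | flat0 (xs : List ℕ)
  /-- second flattening: rows = input coordinates `bs`, columns over `xs × outputs` -/
  | flat1 (xs bs : List ℕ)
  /-- third flattening: rows = output coordinates `cs`, columns over `xs × inputs` -/
  | flat2 (xs cs : List ℕ)
  /-- lookup: `S_{K ++ extra}` is a sandwich image of orbit `j` (witness `P, P⁻¹, Q, Q⁻¹`) -/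
  | look (extra : List ℕ) (j P Pi Q Qi : ℕ)
  /-- forced product (chosen input codes, vectors `w_j`, coordinates `c_j`, elements `xs`, residual rows `sel`) -/
  | forced (ts ws cs xs sel : List ℕ)
  /-- one DFS round: candidates, target, a non-vanishing witness `(x, b, c)`, lookup table
  `(F-mask, orbit, P, P⁻¹, Q, Q⁻¹)`, and the root certificates -/
  | dfs (cands : List ℕ) (target x b c : ℕ) (table : List (ℕ × ℕ × ℕ × ℕ × ℕ × ℕ))
      (roots : Fin cands.length → BCert cands.length)

/-- An orbit certificate: constraint forms, claimed bound, steps. -/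
structure Orbit where
  /-- constraint forms (bit patterns) -/
  K : List ℕ
  /-- claimed lower bound for all computations on `S_K` -/
  bound : ℕ
  /-- justification -/
  steps : List Step

/-- The empty orbit record (default for out-of-range lookups). -/
instance : Inhabited Orbit := ⟨⟨[], 0, []⟩⟩

/-- Leaf helper for data files: the leaf closed by the candidate set with mask `fm`. -/
def BL (N fm : ℕ) : BCert N := BCert.leaf (Finset.univ.filter fun i : Fin N => fm.testBit i)

/-- Node helper for data files: children for the candidate indices `last, last+1, …` in order (others unused). -/
def BN {N : ℕ} (last : ℕ) (kids : List (BCert N)) : BCert N :=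
  BCert.node fun mm => if last ≤ (mm : ℕ) then kids.getD ((mm : ℕ) - last) (BCert.leaf ∅) else BCert.leaf ∅

variable (l m n : ℕ)

/-- The claimed bound of orbit `j`. -/
def bnd (os : List Orbit) (j : ℕ) : ℕ := (os.getD j default).bound

/-- The constraint list of orbit `j`. -/
def kOf (os : List Orbit) (j : ℕ) : List ℕ := (os.getD j default).K

/-- The value of a DFS lookup by `F`-mask. -/
def lookVal (os : List Orbit) (table : List (ℕ × ℕ × ℕ × ℕ × ℕ × ℕ)) (fm : ℕ) : ℕ :=
  match table.find? (fun e => e.1 == fm) with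
  | some e => bnd os e.2.1
  | none => 0

/-- The `LB` oracle of a DFS round. -/
def lbOf (os : List Orbit) (table : List (ℕ × ℕ × ℕ × ℕ × ℕ × ℕ)) {N : ℕ} (F : Finset (Fin N)) : ℕ :=
  lookVal os table (maskOfF F)

/-- Validity of a DFS lookup table: backward pointers and checked sandwiches. -/
def tableOK (os : List Orbit) (i : ℕ) (K cands : List ℕ) (table : List (ℕ × ℕ × ℕ × ℕ × ℕ × ℕ)) : Bool :=
  table.all fun e => decide (e.2.1 < i) &&
    sandB l m (kOf os e.2.1) (K ++ extraOf cands e.1) e.2.2.1 e.2.2.2.1 e.2.2.2.2.1 e.2.2.2.2.2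

/-- The bound certified by one step, given the bound `cur` certified so far (`0` if the step fails). -/
def stepBound (os : List Orbit) (i : ℕ) (K : List ℕ) (cur : ℕ) : Step → ℕ
  | .flat0 xs => if flat0Check l m n K xs = true then xs.length else 0
  | .flat1 xs bs => if flat1Check l m n K xs bs = true then bs.length else 0
  | .flat2 xs cs => if flat2Check l m n K xs cs = true then cs.length else 0
  | .look extra j P Pi Q Qi =>
      if j < i ∧ sandB l m (kOf os j) (K ++ extra) P Pi Q Qi = true then bnd os j else 0
  | .forced ts ws cs xs sel => if forcedPre l m n K ts ws cs xs sel = true then ts.length + sel.length else 0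
  | .dfs cands target x b c table roots =>
      if target ≤ cur + 1 ∧ nzB l m n K x b c = true ∧ coverB l m K cands = true ∧
          tableOK l m os i K cands table = true ∧
          (∀ mm : Fin cands.length,
            (roots mm).check (lbOf os table) target (target - 1) 1 (fun _ => mm) = true)
      then target else 0

/-- The bound certified by an orbit's steps. -/
def orbitBound (os : List Orbit) (i : ℕ) : ℕ :=
  (os.getD i default).steps.foldl (fun cur st => max cur (stepBound l m n os i (kOf os i) cur st)) 0

/-- The orbit check: the claimed bound is certified by the steps. -/
def orbitCheck (os : List Orbit) (i : ℕ) : Bool := decide (bnd os i ≤ orbitBound l m n os i)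

/-- The residual obligation of a step (only forced-product steps carry one). -/
def StepOblig (m n : ℕ) : Step → Prop
  | .forced ts ws cs xs sel => ResidualsOK m n ts ws cs xs sel
  | _ => True

/-- All residual obligations of orbit `i`. -/
def Obligs (os : List Orbit) (i : ℕ) : Prop := ∀ st ∈ (os.getD i default).steps, StepOblig m n st

/-! ## Soundness -/

/-- "`b` is a certified lower bound for all computations on `S_K`". -/
def Cert (K : List ℕ) (b : ℕ) : Prop := ∀ r, BilinComp (psiK l m n K) (Fin r) → b ≤ r

variable {l m n}

/-- More constraints, smaller subspace. -/
theorem subOf_append_le_subOf (l m : ℕ) (K extra : List ℕ) : subOf l m (K ++ extra) ≤ subOf l m K := by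
  intro u hu
  have hu' := (mem_constrSub (K := (K ++ extra).map (form l m))).1 hu
  refine (mem_constrSub (K := K.map (form l m))).2 fun κ hκ => hu' κ ?_
  rw [List.map_append]
  exact List.mem_append_left _ hκ

/-- A bound for `S_{K ++ extra}` is a bound for `S_K`. -/
theorem cert_of_append {K extra : List ℕ} {b : ℕ} (h : Cert l m n (K ++ extra) b) : Cert l m n K b :=
  fun r β => h r (β.ofLE (subOf_append_le_subOf l m K extra))

/-- Soundness of one step. -/
theorem stepBound_sound (os : List Orbit) (i : ℕ) (IH : ∀ j < i, Cert l m n (kOf os j) (bnd os j))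
    (K : List ℕ) (cur : ℕ) (hcur : Cert l m n K cur) (st : Step) (hob : StepOblig m n st) :
    Cert l m n K (stepBound l m n os i K cur st) := by
  cases st with
  | flat0 xs =>
    simp only [stepBound]
    split
    · next h => exact le_of_flat0Check h
    · exact fun _ _ => Nat.zero_le _
  | flat1 xs bs =>
    simp only [stepBound]
    split
    · next h => exact le_of_flat1Check h
    · exact fun _ _ => Nat.zero_le _
  | flat2 xs cs =>
    simp only [stepBound]
    split
    · next h => exact le_of_flat2Check h
    · exact fun _ _ => Nat.zero_le _
  | look extra j P Pi Q Qi =>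
    simp only [stepBound]
    split
    · next h => exact cert_of_append (le_of_sandB h.2 (IH j h.1))
    · exact fun _ _ => Nat.zero_le _
  | forced ts ws cs xs sel =>
    simp only [stepBound]
    split
    · next h => exact le_of_forcedPre h hob
    · exact fun _ _ => Nat.zero_le _
  | dfs cands target x b c table roots =>
    simp only [stepBound]
    split
    · next h =>
      obtain ⟨htgt, hnz, hcov, htab, hroot⟩ := h
      intro r β
      have hLB : ∀ (F : Finset (Fin cands.length)) (r : ℕ),
          BilinComp ((mulBilin (ZMod 2) l m n).comp
            (constrSubF (K.map (form l m)) (candF l m cands) F).subtype) (Fin r) →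
          lbOf os table F ≤ r := by
        intro F r' β'
        simp only [lbOf, lookVal]
        split
        · next e he =>
          have hmem := List.mem_of_find?_eq_some he
          have hfm : e.1 = maskOfF F := by simpa using List.find?_some he
          rw [tableOK, List.all_eq_true] at htab
          have hv := htab e hmem
          simp only [Bool.and_eq_true, decide_eq_true_eq] at hv
          have h1 : Cert l m n (K ++ extraOf cands (maskOfF F)) (bnd os e.2.1) := by
            rw [← hfm]
            exact le_of_sandB hv.2 (IH _ hv.1)
          exact h1 r' (β'.ofLE (subOf_append_le K cands F))
        · exact Nat.zero_le _
      have := le_card_of_check_root (φ := mulBilin (ZMod 2) l m n) (K := K.map (form l m))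
        (c := candF l m cands) hLB (cover_of_coverB hcov) (psiK_ne_zero hnz)
        (fun r' β' => by have := hcur r' β'; omega) roots hroot β
      simpa using this
    · exact fun _ _ => Nat.zero_le _

/-- Soundness of the fold over steps. -/
theorem foldl_sound (os : List Orbit) (i : ℕ) (IH : ∀ j < i, Cert l m n (kOf os j) (bnd os j))
    (K : List ℕ) : ∀ (steps : List Step) (cur : ℕ), Cert l m n K cur → (∀ st ∈ steps, StepOblig m n st) →
      Cert l m n K (steps.foldl (fun cur st => max cur (stepBound l m n os i K cur st)) cur)
  | [], cur, hcur, _ => hcur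
  | st :: steps, cur, hcur, hob => by
    rw [List.foldl_cons]
    refine foldl_sound os i IH K steps _ (fun r β => ?_) (fun st' hst' => hob st' (List.mem_cons_of_mem _ hst'))
    exact max_le (hcur r β) (stepBound_sound os i IH K cur hcur st (hob st List.mem_cons_self) r β)

/-- **The sweep**: if every orbit check passes and all residual obligations hold, every claimed bound is a
lower bound for all computations on its constraint subspace. -/
theorem sweep (os : List Orbit) (hall : ∀ i < os.length, orbitCheck l m n os i = true)
    (hob : ∀ i < os.length, Obligs m n os i) : ∀ i < os.length, Cert l m n (kOf os i) (bnd os i) := by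
  intro i
  induction i using Nat.strong_induction_on with
  | _ i IHi =>
    intro hi
    have IH : ∀ j < i, Cert l m n (kOf os j) (bnd os j) := fun j hj => IHi j hj (lt_trans hj hi)
    have hc := hall i hi
    rw [orbitCheck, decide_eq_true_eq] at hc
    have hf := foldl_sound os i IH (kOf os i) (os.getD i default).steps 0 (fun _ _ => Nat.zero_le _) (hob i hi)
    exact fun r β => hc.trans (hf r β)

/-- **Reading off the rank bound** at the unconstrained orbit. -/
theorem le_tensorRank_of_sweep (os : List Orbit) (hall : ∀ i < os.length, orbitCheck l m n os i = true)
    (hob : ∀ i < os.length, Obligs m n os i) (i : ℕ) (hi : i < os.length) (hK : kOf os i = []) :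
    bnd os i ≤ tensorRank (matMulTensor (ZMod 2) l m n) := by
  have h := sweep os hall hob i hi
  rw [hK] at h
  exact le_tensorRank_matMulTensor_of_forall_constrained (subOf l m []) h

/-! ## Discharging obligations in data files -/

/-- No forced-product step in the list. -/
def noForcedB : List Step → Bool
  | [] => true
  | .forced _ _ _ _ _ :: _ => false
  | _ :: rest => noForcedB rest

/-- Steps without forced products carry no obligation. -/
theorem stepOblig_of_noForced {m n : ℕ} : ∀ steps : List Step, noForcedB steps = true →
    ∀ st ∈ steps, StepOblig m n st
  | [], _, st, hst => by simp at hst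
  | st' :: rest, h, st, hst => by
    rcases List.mem_cons.1 hst with rfl | hmem
    · cases st with
      | forced => simp [noForcedB] at h
      | _ => trivial
    · cases st' with
      | forced => simp [noForcedB] at h
      | _ => exact stepOblig_of_noForced rest (by simpa [noForcedB] using h) st hmem

/-- Obligations of an orbit without forced-product steps. -/
theorem obligs_of_noForced {m n : ℕ} (os : List Orbit) (i : ℕ)
    (h : noForcedB (os.getD i default).steps = true) : Obligs m n os i :=
  stepOblig_of_noForced _ h

/-- Obligations of an orbit whose first step is its only forced product. -/
theorem obligs_of_forced_cons {m n : ℕ} (os : List Orbit) (i : ℕ) (ts ws cs xs sel : List ℕ)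
    (rest : List Step) (h : (os.getD i default).steps = Step.forced ts ws cs xs sel :: rest)
    (hr : ResidualsOK m n ts ws cs xs sel) (hrest : noForcedB rest = true) : Obligs m n os i := by
  intro st hst
  rw [h] at hst
  rcases List.mem_cons.1 hst with rfl | hmem
  · exact hr
  · exact stepOblig_of_noForced rest hrest st hmem

/-! ## Chunked discharge of residual obligations -/

/-- `p` holds on `[lo, lo + k)`. -/
def allRange (p : ℕ → Bool) : ℕ → ℕ → Bool
  | _, 0 => true
  | lo, k + 1 => p lo && allRange p (lo + 1) k

/-- Specification of `allRange`. -/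
theorem allRange_spec (p : ℕ → Bool) : ∀ (k lo : ℕ), allRange p lo k = true →
    ∀ x, lo ≤ x → x < lo + k → p x = true
  | 0, lo, _, x, h1, h2 => by omega
  | k + 1, lo, h, x, h1, h2 => by
    rw [allRange, Bool.and_eq_true] at h
    rcases Nat.eq_or_lt_of_le h1 with rfl | hlt
    · exact h.1
    · exact allRange_spec p k (lo + 1) h.2 x hlt (by omega)

/-- Chunks of width `w` cover `[0, C w)`. -/
theorem forall_lt_of_chunks (p : ℕ → Bool) (w C : ℕ) (h : ∀ k < C, allRange p (k * w) w = true) :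
    ∀ x < C * w, p x = true := by
  intro x hx
  have hw : 0 < w := Nat.pos_of_ne_zero fun h0 => by subst h0; simp at hx
  have hk : x / w < C := by rwa [Nat.div_lt_iff_lt_mul hw]
  exact allRange_spec p w (x / w * w) (h _ hk) x (Nat.div_mul_le_self x w)
    (by have := Nat.lt_div_mul_add hw (a := x); linarith [Nat.mod_lt x hw, Nat.div_add_mod x w])

end Summit.MatrixMultiplication.OmegaCensus.GF2RankLB
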